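import Summits.BirchSwinnertonDyer.BirchSwinnertonDyer.Theorems.SmallImageMuTransferAnalyticMuZeroX9NoCMPartnerExceptionalS4GL2
import Summits.BirchSwinnertonDyer.BirchSwinnertonDyer.Theorems.Rank1ResidualX9CMPartner
import Literature.NumberTheory.EllipticCurves.Rank1Residual.X9ImageShape
import HarnessLib

/-!
# Route `SmallImageMuTransfer` (rung K6, leaf `BSDpOnClassX9`), crux `AnalyticMuZeroX9NoCMPartner`:
# the exceptional branch of the image-shape dichotomy IS type `5S4`
# (`p = 5`, projective image `𝔖₄`) — KERNEL, unconditional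

HONEST FRAMING (cell `b2b-bsdres`, X9 prover lineage; verbatim): the cell deletes COMBINATION-SHAPED
residual classes of the rank-≤1 BSD formula from PUBLISHED theorems only and TYPES the
construction-shaped remainder; this is not "finishing BSD".  Nothing below asserts anything about
any curve beyond what the kernel proves; class X9 stays TYPED at class level; no pair, count, mark or
tier word moves.  Helper file (`--supports stmt-BirchSwinnertonDyer-19235 --as helper`): it closes
no stub and no item; it refines the HYPOTHESIS of a registered stub.

The crux `AnalyticMuZeroX9NoCMPartner` (stmt-BirchSwinnertonDyer-19235, child of the split D1 of
`AnalyticMuZeroX9`; cell `bsd-smallim`) has the registered BC3 skeleton (sha16 05f45d2aa39320d7)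

  `AnalyticMuZeroX9NoCMPartner ⇐ stub_dihedral_noCM ⊔ stub_exceptional_noCM`,

split, in a frame `(Φ, e)` of `E[p]` with `G = Φ(ρ̄_{E,p}(Γ_ℚ)) ≤ GL₂(𝔽_p)`, on
`∃ P, G ≤ N(P (* 0; 0 *) P⁻¹) ∧ ¬ G ≤ P (* 0; 0 *) P⁻¹` (dihedral branch) versus its negation
(exceptional branch).  The planner's by-name ask (bsd-smallim STATUS 2026-08-26T03:12:31Z (2)):
the kernel dichotomy at `p = 5` — "`ClassX9 W 5 ⇒ image ≤ N(C_s) ⊄ C_s ∨ projective image ≅ S₄`" —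
refining `stub_exceptional_noCM`'s hypothesis to "projective image `𝔖₄`".  This file proves it,
for every `p` at once, from the group theory of
`SmallImageMuTransferAnalyticMuZeroX9NoCMPartnerExceptionalS4GL2.lean`
(`ExceptionalS4.eq_five_and_nonempty_mulEquiv_perm`: Serre 1972 Prop. 14, §2.6, Prop. 16):

* `ClassX9.eq_five_and_nonempty_mulEquiv_perm_of_not_splitCartan_normalizer` — under EXACTLY the
  hypotheses of `stub_exceptional_noCM` (`Rank1Residual.ClassX9 W p`, a frame `(Φ, e, he)`, the
  negated dihedral clause): `p = 5 ∧ Nonempty (Ḡ ≃* Equiv.Perm (Fin 4))`,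
  `Ḡ = (G).map Matrix.ProjGenLinGroup.mk ≤ PGL₂(𝔽_p)`.  Inputs from the tree: `p ∤ |G|` (Prop. 15
  with `det G = 𝔽_pˣ`, irreducibility, non-surjectivity: `eq_top_or_borel_of_dvd_card`,
  `exists_mem_map_range_det_eq`, `map_range_galoisRepTorsion_eq_top_iff`,
  `not_le_eigenvectorStabilizer_of_hasIrreducibleModPGaloisRep`) and the inertia split half-Cartan
  subgroup at a good ORDINARY prime (§1.11; `Rank1Residual.exists_halfSplitCartan_le_image_of_goodOrd`,
  X9 gen 3), reached through `classX9_census_of_classX9`.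
* `ClassX9.eq_five_and_isOctahedralType_of_not_splitCartan_normalizer` — the same in the Klein-type
  vocabulary of `GaloisRepresentations/ProjectiveType`: `IsOctahedralType (Φ ∘ ρ̄_{E,p})`.
* `ClassX9.splitCartan_normalizer_or_eq_five_and_nonempty_mulEquiv_perm` — the informative excluded
  middle the skeleton's composition `AnalyticMuZeroX9NoCMPartner_of` splits on: dihedral branch, or
  (`p = 5` and `Ḡ ≃* 𝔖₄`).

Consequences for the line (prose): `stub_exceptional_noCM` quantifies over `5S4` pairs only — it is
vacuous at `p ≠ 5` (at `p ≥ 7` `ClassX9.exists_splitCartan_normalizer` already said so) and at the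
`5Ns` pairs; the census words "624 of the 699 no-CM-partner X9 pairs are `5S4`" now have a kernel
predicate.  No new definition, no named fact, no `sorry`; axioms standard.
(X9 prover GEN 40, 2026-08-26.)

## References

* [Serre1972] J.-P. Serre, *Propriétés galoisiennes des points d'ordre fini des courbes
  elliptiques*, Invent. Math. 15 (1972) 259–331: §1.11 Cor. to Prop. 11; §2.4 Prop. 15; §2.5
  Prop. 16; §2.6; §2.7 Prop. 17 and the remark on `p = 5`.
-/

-- the summit and its single problem are both named `BirchSwinnertonDyer` (registry layout D-0017)
set_option linter.dupNamespace false

set_option autoImplicit false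

noncomputable section

open scoped Classical MatrixGroups
open Matrix WeierstrassCurve Field
open Literature.NumberTheory.GaloisRepresentations
  Literature.NumberTheory.GaloisRepresentations.Serre1972

namespace Summit.BirchSwinnertonDyer.BirchSwinnertonDyer.Rank1Residual

/-! ### Class X9: the exceptional branch is `p = 5`, projective image `𝔖₄` (type `5S4`) -/

section ClassLevel

variable (W : WeierstrassCurve ℚ) [W.IsElliptic] [W.IsGloballyMinimal] (p : ℕ) [Fact p.Prime]
  (Φ : Multiplicative (AddAut (geomTorsion W p)) ≃* GL (Fin 2) (ZMod p))
  (e : geomTorsion W p ≃+ (Fin 2 → ZMod p))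
  (he : ∀ (g : Multiplicative (AddAut (geomTorsion W p))) (x : geomTorsion W p),
    e (Multiplicative.toAdd g x) =
      ((Φ g : GL (Fin 2) (ZMod p)) : Matrix (Fin 2) (Fin 2) (ZMod p)) *ᵥ e x)

include he

/-- **X9, exceptional branch ⟹ `p = 5` and projective image `𝔖₄` (KERNEL, unconditional).**
Let `(E, p) = (W, p)` be an X9 pair (`Rank1Residual.ClassX9`: non-CM, `p ≥ 5` good ORDINARY,
`E[p]` irreducible, `ρ̄_{E,p}` not onto) and `(Φ, e)` a frame of `E[p]`, `G = Φ(ρ̄(Γ_ℚ))`.  If `G`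
normalises no split Cartan subgroup except by lying inside it — the hypothesis of the registered
stub `stub_exceptional_noCM` of crux `AnalyticMuZeroX9NoCMPartner` (stmt-BirchSwinnertonDyer-19235),
verbatim — then `p = 5` and the image of `G` in `PGL₂(𝔽_p)` is isomorphic to `𝔖₄`: the pair is
of Sutherland type `5S4`.  Inputs, all kernel theorems of the tree: the inertia split half-Cartan
at a good ordinary prime (Serre §1.11, `exists_halfSplitCartan_le_image_of_goodOrd`), `p ∤ |G|`
(Prop. 15 with `det G = 𝔽_pˣ`, irreducibility and non-surjectivity, `eq_top_or_borel_of_dvd_card`),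
and `ExceptionalS4.eq_five_and_nonempty_mulEquiv_perm` (Prop. 14, §2.6, Prop. 16).  So
`stub_exceptional_noCM` is a statement about `5S4` pairs only (vacuous at every `p ≠ 5`), and
`stub_dihedral_noCM` carries every other X9 pair without CM partner.
[cite: Serre1972, §2.7, Prop. 17 and the remark on `p = 5`; §2.6; §2.5 Prop. 16] -/
theorem ClassX9.eq_five_and_nonempty_mulEquiv_perm_of_not_splitCartan_normalizer
    (h : ClassX9 W p)
    (hexc : ¬ ∃ P : GL (Fin 2) (ZMod p),
      (galoisRepTorsion W p).range.map Φ.toMonoidHom ≤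
          Subgroup.normalizer (splitCartan P : Set (GL (Fin 2) (ZMod p))) ∧
      ¬ (galoisRepTorsion W p).range.map Φ.toMonoidHom ≤ splitCartan P) :
    p = 5 ∧ Nonempty (((galoisRepTorsion W p).range.map Φ.toMonoidHom).map
      Matrix.ProjGenLinGroup.mk ≃* Equiv.Perm (Fin 4)) := by
  obtain ⟨-, hord, h5, hirr, hns, -⟩ := classX9_census_of_classX9 W p h
  have hpG : ¬ p ∣ Nat.card ((galoisRepTorsion W p).range.map Φ.toMonoidHom) := by
    intro hdvd
    rcases eq_top_or_borel_of_dvd_card _ hdvd (exists_mem_map_range_det_eq W p Φ e he) with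
      htop | ⟨w, hw, hB⟩
    · exact hns ((map_range_galoisRepTorsion_eq_top_iff W p Φ).mp htop)
    · exact not_le_eigenvectorStabilizer_of_hasIrreducibleModPGaloisRep W p Φ e he hirr hw hB
  obtain ⟨P, hP⟩ :=
    Literature.NumberTheory.EllipticCurves.Rank1Residual.exists_halfSplitCartan_le_image_of_goodOrd
      W p Φ e he hord
  exact ExceptionalS4.eq_five_and_nonempty_mulEquiv_perm h5 _ hpG hP
    (fun v hv ↦ not_le_eigenvectorStabilizer_of_hasIrreducibleModPGaloisRep W p Φ e he hirr hv)
    hexc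

/-- **The same in the tree's Klein-type vocabulary** (`GaloisRepresentations/ProjectiveType`):
under the hypotheses of `stub_exceptional_noCM`, `p = 5` and the framed mod-`p` representation
`Φ ∘ ρ̄_{E,p} : Γ_ℚ → GL₂(𝔽_p)` is of OCTAHEDRAL type — its `projectiveImage` is `≃* 𝔖₄`.
[cite: Serre1972, §2.7, Prop. 17 and the remark on `p = 5`; §2.5 Prop. 16] -/
theorem ClassX9.eq_five_and_isOctahedralType_of_not_splitCartan_normalizer
    (h : ClassX9 W p)
    (hexc : ¬ ∃ P : GL (Fin 2) (ZMod p),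
      (galoisRepTorsion W p).range.map Φ.toMonoidHom ≤
          Subgroup.normalizer (splitCartan P : Set (GL (Fin 2) (ZMod p))) ∧
      ¬ (galoisRepTorsion W p).range.map Φ.toMonoidHom ≤ splitCartan P) :
    p = 5 ∧ IsOctahedralType (Φ.toMonoidHom.comp (galoisRepTorsion W p)) := by
  obtain ⟨hp5, ⟨f⟩⟩ :=
    ClassX9.eq_five_and_nonempty_mulEquiv_perm_of_not_splitCartan_normalizer W p Φ e he h hexc
  refine ⟨hp5, ⟨(MulEquiv.subgroupCongr ?_).trans f⟩⟩
  rw [projectiveImage_eq_map_range, MonoidHom.range_comp]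

/-- **The X9 image dichotomy at the level of the crux skeleton** (excluded middle made
informative): for an X9 pair and any frame, EITHER the image normalises a split Cartan subgroup
`C = P (* 0; 0 *) P⁻¹` without lying in it (dihedral branch, `stub_dihedral_noCM`; `ρ̄ ≅ Ind_M χ̄`)
OR `p = 5` and the projective image is `𝔖₄` (exceptional branch = type `5S4`,
`stub_exceptional_noCM`).  At `p ≥ 7` the first branch always holds
(`ClassX9.exists_splitCartan_normalizer`, Prop. 17); at `p = 5` both occur (`5Ns` and `5S4`).
[cite: Serre1972, §2.7, Prop. 17 and the remark on `p = 5`; §2.5 Prop. 16] -/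
theorem ClassX9.splitCartan_normalizer_or_eq_five_and_nonempty_mulEquiv_perm (h : ClassX9 W p) :
    (∃ P : GL (Fin 2) (ZMod p),
      (galoisRepTorsion W p).range.map Φ.toMonoidHom ≤
          Subgroup.normalizer (splitCartan P : Set (GL (Fin 2) (ZMod p))) ∧
      ¬ (galoisRepTorsion W p).range.map Φ.toMonoidHom ≤ splitCartan P) ∨
    (p = 5 ∧ Nonempty (((galoisRepTorsion W p).range.map Φ.toMonoidHom).map
      Matrix.ProjGenLinGroup.mk ≃* Equiv.Perm (Fin 4))) := by
  by_cases hdih : ∃ P : GL (Fin 2) (ZMod p),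
      (galoisRepTorsion W p).range.map Φ.toMonoidHom ≤
          Subgroup.normalizer (splitCartan P : Set (GL (Fin 2) (ZMod p))) ∧
      ¬ (galoisRepTorsion W p).range.map Φ.toMonoidHom ≤ splitCartan P
  · exact Or.inl hdih
  · exact Or.inr
      (ClassX9.eq_five_and_nonempty_mulEquiv_perm_of_not_splitCartan_normalizer W p Φ e he h hdih)

end ClassLevel

end Summit.BirchSwinnertonDyer.BirchSwinnertonDyer.Rank1Residual

end
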